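import Summits.HodgeConjecture.HodgeConjecture.Theorems.F0P3cStCharTSFinOfL2        -- ★ p848594 K4 «FIN-OF-L2» (→ ★ K1∕K2, «ELL-LIN», «BESSEL-FIN», carpets)
import HarnessLib

/-!
# F0 · P3c · line LH6 «StCharTS» — «Sa-COMPOSE★» piece K4′ «FIN-OF-L2-PSEUDO»: K2∕K4 with the transfer-existence and identity hypotheses RESTRICTED TO PSEUDO-COEFFICIENTS of
# square-integrable classes (the only test functions the proofs use) — the form consumed by (F) on the regrouped identity of interface v2, where the
# principal-series part vanishes exactly at such test functions (socket (PSE))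

Cell `pub/hodgecm-mathlib`, crux H413 = `stmt-HodgeConjecture-24833` (lane `--supports … --as helper`), route HCCMUnconditional; seat LH6-p05 (g0); desk F0P3b-plan (g23)
deal 03:07:39Z «Sa-COMPOSE★» (organ (S-a) `stub_StSupportFiniteSqInt`, leaf `Cruxes/H413/Lines/F0_P3c_StCharTSPaydown.lean` ED. 1 :158).  THEOREMS ONLY, sorry-free, GENERIC
over `𝔇 : EllipticData G H`; imports ★ K1∕K2 only.
HONEST LABEL: HC_CM is proved only modulo the 7 printed citations (2 remaining: hLiu418 = `stmt-HodgeConjecture-24832`, h413 = `stmt-HodgeConjecture-24833`) until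
rung 0 closes; count-neutral, hypothesis-fed.

THE MATHEMATICS.  [Rogawski1990, L. 12.7.2 proof pp. 193–194]: the organ (S-a) says «`supp a` finite AND every member square-integrable».  Print gets «square-integrable»
from the torus step (rows (a)(c) of the road card `F0/P3b/LH6-p05/g0/ROAD-Sa.v1.md` — the part whose inputs no carpet states yet) and «finite» from the elliptic theory
(row (b)).  This file is the kernel form of the implication (S-a).2 ⇒ (S-a).1: once every member is square-integrable, the identity tested at a pseudo-coefficient `f_π` of a
member reads `⟨χ^G_ρ, χ_π⟩_e = a(π)` (two distinct square-integrable classes are `⟨ , ⟩_e`-orthogonal: Prop. 12.6.1 (a)(b) + «`ψ∘det`, `πⁿ(ξ)`, the l.d.s. members are not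
square-integrable» §12.2), so `supp a ⊆ {π square-integrable : ⟨χ^G_ρ, χ_π⟩_e ≠ 0}`, which is finite by ★ «L2-FIN» (Bessel, «`χ^G_ρ` has bounded elliptic norm»).
So the (S-a) HEAD = this file ∘ [rows (a)(c)], and its only inputs outside the carpets are the datum-coherence ∕ regularity sockets listed on the squad bus (03:31Z, 03:45Z,
03:52Z) for `Ch12Sec5Inputs` ED. 2.

* `exists_int_innerG_eq_of_isL2_pseudo`, `finite_isL2_innerG_ne_zero_pseudo`, `innerG_eq_coeff_of_members_isL2_pseudo`, **`support_finite_of_members_isL2_pseudo`** —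
  verbatim ★ K2∕K4 with `hTv`∕`hid` quantified over pseudo-coefficients `f_π` of square-integrable `π` only.

## References
* [Rogawski1990] J. D. Rogawski, *Automorphic Representations of Unitary Groups in Three Variables*, Ann. of Math. Stud. 123 (1990): §12.7 L. 12.7.2 proof pp. 193–194;
  §12.6 Prop. 12.6.1 p. 188; §12.2 pp. 173–174.
-/

set_option autoImplicit false
-- the mandated namespace has the single-problem summit's repeated segment (`HodgeConjecture.HodgeConjecture`)
set_option linter.dupNamespace false

noncomputable section

open MeasureTheory Filter Topology
open scoped BigOperators ComplexConjugate

namespace Summit.HodgeConjecture.HodgeConjecture.Cruxes.H413.F0P3cStCharTSFinOfL2Pseudo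

open Literature.NumberTheory.Rogawski1990.Ch12Sec5 Literature.NumberTheory.Rogawski1990 Literature.NumberTheory.Automorphic
open Summit.HodgeConjecture.HodgeConjecture.Cruxes.H413 Summit.HodgeConjecture.HodgeConjecture.Cruxes.H413.F0P3cStCharTSScFin
open Summit.HodgeConjecture.HodgeConjecture.Cruxes.H413.F0P3cStCharTSFinOfL2

variable {G H : Type} [Group G] [TopologicalSpace G] [IsTopologicalGroup G] [MeasurableSpace G]
  [∀ γ : G, MeasurableSpace (G ⧸ Subgroup.centralizer ({γ} : Set G))] [MeasurableSpace (G ⧸ Subgroup.center G)]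
  [Group H] [TopologicalSpace H] [IsTopologicalGroup H] [MeasurableSpace H]
  (𝔇 : EllipticData G H)

/-- **Integrality of the coefficients**: for a square-integrable class `π` with pseudo-coefficient `f` and matched `f^H`, `⟨x, χ_π⟩_{G,e}` is an integer.
[cite: Rogawski1990, §12.7 L. 12.7.2 proof p. 193; §12.6 Prop. 12.6.1 p. 188] -/
theorem exists_int_innerG_eq_of_isL2_pseudo
    (hTell : ∀ T ∈ 𝔇.cartanG, ∀ᵐ t : ↥T ∂(𝔇.μT T), (t : G) ∈ 𝔇.ellG)
    (hEllL2 : ∀ π : IrrClass G, 𝔇.IsL2 π → 𝔇.IsEllipticRep π)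
    (hPCT : Ch12Sec6.PseudoCoeffTrace 𝔇)
    (h61a : Ch12Sec6.Prop1261a 𝔇) (h61b : Ch12Sec6.Prop1261b 𝔇) (h61c : Ch12Sec6.Prop1261c 𝔇)
    (S_H : (H → ℂ) → Prop) (M : (H → ℂ) → (G → ℂ) → Prop) (R : (H → ℂ) → ℂ)
    (hMT : ∀ (fH : H → ℂ) (φ : G → ℂ), M fH φ → 𝔇.IsTransfer φ fH)
    (aX : IrrClass G → ℤ)
    (hid : ∀ (π₀ : IrrClass G) (fH : H → ℂ) (φ : G → ℂ), 𝔇.IsL2 π₀ → 𝔇.IsPseudoCoeff π₀ φ → S_H fH → M fH φ →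
      Summable (fun π : IrrClass G => (aX π : ℂ) * π.smoothTrace 𝔇.μG φ) ∧
        ∑' π : IrrClass G, (aX π : ℂ) * π.smoothTrace 𝔇.μG φ = R fH)
    (x : G → ℂ)
    (hup : ∀ (π : IrrClass G) (f : G → ℂ) (fH : H → ℂ), 𝔇.IsPseudoCoeff π f → 𝔇.IsTransfer f fH → S_H fH → R fH = 𝔇.innerG x (𝔇.char π))
    {π : IrrClass G} (hπ : 𝔇.IsL2 π) {f : G → ℂ} (hf : 𝔇.IsPseudoCoeff π f) {fH : H → ℂ} (hfH : S_H fH) (hm : M fH f) :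
    ∃ n : ℤ, 𝔇.innerG x (𝔇.char π) = n := by
  classical
  have hell : 𝔇.IsEllipticRep π := hEllL2 π hπ
  obtain ⟨hsum, htsum⟩ := hid π fH f hπ hf hfH hm
  -- every term is an integer multiple of `aX π′`
  have hterm : ∀ π' : IrrClass G, ∃ m : ℤ, (aX π' : ℂ) * π'.smoothTrace 𝔇.μG f = (m : ℂ) := by
    intro π'
    rw [hPCT π π' f hf]
    by_cases heq : π' = π
    · subst heq
      exact ⟨aX π', by rw [(h61a π' hell).2 hπ, mul_one]⟩
    · by_cases hell' : 𝔇.IsEllipticRep π'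
      · by_cases h0 : 𝔇.innerG (𝔇.char π') (𝔇.char π) = 0
        · exact ⟨0, by rw [h0, mul_zero, Int.cast_zero]⟩
        · refine ⟨-aX π', ?_⟩
          rw [h61c π' π heq (h61b π' π hell' hell h0 heq)]
          push_cast
          ring
      · exact ⟨0, by rw [innerG_eq_zero_of_not_isEllipticRep 𝔇 hTell hell' _, mul_zero, Int.cast_zero]⟩
  choose m hm' using hterm
  -- a summable family of integers has finite support
  have hsum' : Summable fun π' : IrrClass G => ((m π' : ℤ) : ℂ) := hsum.congr hm'
  have hfin : (Function.support fun π' : IrrClass G => ((m π' : ℤ) : ℂ)).Finite :=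
    F0P3cStCharTSBesselFin.finite_support_of_summable_of_le_norm _ zero_lt_one
      (fun π' hne => by
        have hne' : m π' ≠ 0 := fun h0 => hne (by rw [h0, Int.cast_zero])
        rw [Complex.norm_intCast]
        exact_mod_cast Int.one_le_abs hne') hsum'
  refine ⟨∑ π' ∈ hfin.toFinset, m π', ?_⟩
  rw [← hup π f fH hf (hMT fH f hm) hfH, ← htsum, tsum_congr hm', tsum_eq_sum (s := hfin.toFinset) fun π' hπ' => ?_, Int.cast_sum]
  rwa [Set.Finite.mem_toFinset, Function.mem_support, not_not] at hπ'

/-- **«L2-FIN»: only finitely many square-integrable classes pair non-trivially with `x = χ^G_ρ`** — Bessel (★ «BESSEL-FIN») over the `⟨ , ⟩_e`-orthonormal family of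
square-integrable characters (Prop. 12.6.1 (a)(b) + «an elliptic pair has at most one square-integrable member» + «square-integrable ⇒ elliptic»), the coefficients
`⟨x, χ_π⟩_e` being integers (`exists_int_innerG_eq_of_isL2_pseudo`). [cite: Rogawski1990, §12.7 L. 12.7.2 proof p. 193; §12.6 Prop. 12.6.1 p. 188; §12.5 p. 184] -/
theorem finite_isL2_innerG_ne_zero_pseudo
    (hTell : ∀ T ∈ 𝔇.cartanG, ∀ᵐ t : ↥T ∂(𝔇.μT T), (t : G) ∈ 𝔇.ellG)
    (hEllL2 : ∀ π : IrrClass G, 𝔇.IsL2 π → 𝔇.IsEllipticRep π)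
    (hpairL2 : ∀ π π' : IrrClass G, 𝔇.IsEllipticPair π π' → 𝔇.IsL2 π → ¬ 𝔇.IsL2 π')
    (hL2dom : ∀ π : IrrClass G, 𝔇.IsL2 π → ∀ T ∈ 𝔇.cartanG, MemLp (fun t : ↥T => (𝔇.DG (t : G) : ℂ) * 𝔇.char π (t : G)) 2 (𝔇.μT T))
    (hPCE : Ch12Sec6.PseudoCoeffExists 𝔇) (hPCT : Ch12Sec6.PseudoCoeffTrace 𝔇)
    (h61a : Ch12Sec6.Prop1261a 𝔇) (h61b : Ch12Sec6.Prop1261b 𝔇) (h61c : Ch12Sec6.Prop1261c 𝔇)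
    (S_H : (H → ℂ) → Prop) (M : (H → ℂ) → (G → ℂ) → Prop) (R : (H → ℂ) → ℂ)
    (hTv : ∀ (π : IrrClass G) (φ : G → ℂ), 𝔇.IsL2 π → 𝔇.IsPseudoCoeff π φ → ∃ fH : H → ℂ, S_H fH ∧ M fH φ)
    (hMT : ∀ (fH : H → ℂ) (φ : G → ℂ), M fH φ → 𝔇.IsTransfer φ fH)
    (aX : IrrClass G → ℤ)
    (hid : ∀ (π₀ : IrrClass G) (fH : H → ℂ) (φ : G → ℂ), 𝔇.IsL2 π₀ → 𝔇.IsPseudoCoeff π₀ φ → S_H fH → M fH φ →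
      Summable (fun π : IrrClass G => (aX π : ℂ) * π.smoothTrace 𝔇.μG φ) ∧
        ∑' π : IrrClass G, (aX π : ℂ) * π.smoothTrace 𝔇.μG φ = R fH)
    (x : G → ℂ) (hx : ∀ T ∈ 𝔇.cartanG, MemLp (fun t : ↥T => (𝔇.DG (t : G) : ℂ) * x (t : G)) 2 (𝔇.μT T))
    (hup : ∀ (π : IrrClass G) (f : G → ℂ) (fH : H → ℂ), 𝔇.IsPseudoCoeff π f → 𝔇.IsTransfer f fH → S_H fH → R fH = 𝔇.innerG x (𝔇.char π)) :
    {π : IrrClass G | 𝔇.IsL2 π ∧ 𝔇.innerG x (𝔇.char π) ≠ 0}.Finite := by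
  classical
  have horth : ∀ i ∈ {π : IrrClass G | 𝔇.IsL2 π}, ∀ j ∈ {π : IrrClass G | 𝔇.IsL2 π},
      𝔇.innerG (𝔇.char i) (𝔇.char j) = if i = j then 1 else 0 := by
    intro i hi j hj
    by_cases hij : i = j
    · subst hij
      rw [if_pos rfl]
      exact (h61a i (hEllL2 i hi)).2 hi
    · rw [if_neg hij]
      by_contra hne0
      exact hpairL2 i j (h61b i j (hEllL2 i hi) (hEllL2 j hj) hne0 hij) hi hj
  have hint : ∀ π ∈ {π : IrrClass G | 𝔇.IsL2 π}, ∃ n : ℤ, 𝔇.innerG x (𝔇.char π) = n := by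
    intro π hπ
    obtain ⟨f, hf⟩ := hPCE π (hEllL2 π hπ)
    obtain ⟨fH, hfH, hm⟩ := hTv π f hπ hf
    exact exists_int_innerG_eq_of_isL2_pseudo 𝔇 hTell hEllL2 hPCT h61a h61b h61c S_H M R hMT aX hid x hup hπ hf hfH hm
  have hfin := F0P3cStCharTSBesselFin.finite_of_pairing_orthonormal_of_int
    (fun α : G → ℂ => ∀ T ∈ 𝔇.cartanG, MemLp (fun t : ↥T => (𝔇.DG (t : G) : ℂ) * α (t : G)) 2 (𝔇.μT T)) 𝔇.innerG
    (F0P3cStCharTSEllLin.isEllL2_zero 𝔇) (fun _ _ h1 h2 => F0P3cStCharTSEllLin.isEllL2_add 𝔇 h1 h2)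
    (fun c _ h => F0P3cStCharTSEllLin.isEllL2_smul 𝔇 c h)
    (fun _ _ _ h1 h2 h3 => F0P3cStCharTSEllLin.innerG_add_left 𝔇 h1 h2 h3) (fun c a z _ _ => F0P3cStCharTSEllLin.innerG_smul_left 𝔇 c a z)
    (fun _ _ _ h1 h2 h3 => F0P3cStCharTSEllLin.innerG_add_right 𝔇 h1 h2 h3) (fun c a z _ _ => F0P3cStCharTSEllLin.innerG_smul_right 𝔇 c a z)
    (fun a b _ _ => innerG_conj_symm 𝔇 a b) (fun y hy => innerG_self_re_nonneg 𝔇 hy)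
    {π : IrrClass G | 𝔇.IsL2 π} 𝔇.char (fun π hπ => hL2dom π hπ) horth x hx hint
  exact hfin.subset fun π hπ => ⟨hπ.1, hπ.2⟩

/-- **The tested identity for a square-integrable member when ALL members are square-integrable**: `⟨x, χ_π⟩_{G,e} = aX(π)`.
[cite: Rogawski1990, §12.7 L. 12.7.2 proof pp. 193–194; §12.6 Prop. 12.6.1 p. 188] -/
theorem innerG_eq_coeff_of_members_isL2_pseudo
    (hTell : ∀ T ∈ 𝔇.cartanG, ∀ᵐ t : ↥T ∂(𝔇.μT T), (t : G) ∈ 𝔇.ellG)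
    (hEllL2 : ∀ π : IrrClass G, 𝔇.IsL2 π → 𝔇.IsEllipticRep π)
    (hpairL2 : ∀ π π' : IrrClass G, 𝔇.IsEllipticPair π π' → 𝔇.IsL2 π → ¬ 𝔇.IsL2 π')
    (hPCT : Ch12Sec6.PseudoCoeffTrace 𝔇) (h61a : Ch12Sec6.Prop1261a 𝔇) (h61b : Ch12Sec6.Prop1261b 𝔇)
    (S_H : (H → ℂ) → Prop) (M : (H → ℂ) → (G → ℂ) → Prop) (R : (H → ℂ) → ℂ)
    (hMT : ∀ (fH : H → ℂ) (φ : G → ℂ), M fH φ → 𝔇.IsTransfer φ fH)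
    (aX : IrrClass G → ℤ) (hall : ∀ π : IrrClass G, aX π ≠ 0 → 𝔇.IsL2 π)
    (hid : ∀ (π₀ : IrrClass G) (fH : H → ℂ) (φ : G → ℂ), 𝔇.IsL2 π₀ → 𝔇.IsPseudoCoeff π₀ φ → S_H fH → M fH φ →
      Summable (fun π : IrrClass G => (aX π : ℂ) * π.smoothTrace 𝔇.μG φ) ∧
        ∑' π : IrrClass G, (aX π : ℂ) * π.smoothTrace 𝔇.μG φ = R fH)
    (x : G → ℂ)
    (hup : ∀ (π : IrrClass G) (f : G → ℂ) (fH : H → ℂ), 𝔇.IsPseudoCoeff π f → 𝔇.IsTransfer f fH → S_H fH → R fH = 𝔇.innerG x (𝔇.char π))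
    {π : IrrClass G} (hπ : 𝔇.IsL2 π) {f : G → ℂ} (hf : 𝔇.IsPseudoCoeff π f) {fH : H → ℂ} (hfH : S_H fH) (hm : M fH f) :
    𝔇.innerG x (𝔇.char π) = (aX π : ℂ) := by
  classical
  have hell : 𝔇.IsEllipticRep π := hEllL2 π hπ
  obtain ⟨_, hsum⟩ := hid π fH f hπ hf hfH hm
  have hvanish : ∀ π' : IrrClass G, π' ≠ π → (aX π' : ℂ) * π'.smoothTrace 𝔇.μG f = 0 := by
    intro π' hne
    by_cases ha : aX π' = 0
    · rw [ha, Int.cast_zero, zero_mul]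
    · rw [hPCT π π' f hf]
      refine mul_eq_zero_of_right _ ?_
      by_cases hell' : 𝔇.IsEllipticRep π'
      · by_contra hne0
        exact hpairL2 π' π (h61b π' π hell' hell hne0 hne) (hall π' ha) hπ
      · exact innerG_eq_zero_of_not_isEllipticRep 𝔇 hTell hell' _
  have htsum : ∑' π' : IrrClass G, (aX π' : ℂ) * π'.smoothTrace 𝔇.μG f = (aX π : ℂ) := by
    rw [tsum_eq_single π hvanish, hPCT π π f hf, (h61a π hell).2 hπ, mul_one]
  rw [← hup π f fH hf (hMT fH f hm) hfH, ← hsum, htsum]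

/-- **«FIN-OF-L2» — the (b)-row half of the (S-a) head**: if every member of the (β)-datum is square-integrable (the output of the torus step, rows (a)(c)), the support is
FINITE: `supp aX ⊆ {π square-integrable : ⟨x, χ_π⟩_e ≠ 0}`, finite by `finite_isL2_innerG_ne_zero_pseudo`. [cite: Rogawski1990, §12.7 L. 12.7.2 proof pp. 193–194] -/
theorem support_finite_of_members_isL2_pseudo
    (hTell : ∀ T ∈ 𝔇.cartanG, ∀ᵐ t : ↥T ∂(𝔇.μT T), (t : G) ∈ 𝔇.ellG)
    (hEllL2 : ∀ π : IrrClass G, 𝔇.IsL2 π → 𝔇.IsEllipticRep π)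
    (hpairL2 : ∀ π π' : IrrClass G, 𝔇.IsEllipticPair π π' → 𝔇.IsL2 π → ¬ 𝔇.IsL2 π')
    (hL2dom : ∀ π : IrrClass G, 𝔇.IsL2 π → ∀ T ∈ 𝔇.cartanG, MemLp (fun t : ↥T => (𝔇.DG (t : G) : ℂ) * 𝔇.char π (t : G)) 2 (𝔇.μT T))
    (hPCE : Ch12Sec6.PseudoCoeffExists 𝔇) (hPCT : Ch12Sec6.PseudoCoeffTrace 𝔇)
    (h61a : Ch12Sec6.Prop1261a 𝔇) (h61b : Ch12Sec6.Prop1261b 𝔇) (h61c : Ch12Sec6.Prop1261c 𝔇)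
    (S_H : (H → ℂ) → Prop) (M : (H → ℂ) → (G → ℂ) → Prop) (R : (H → ℂ) → ℂ)
    (hTv : ∀ (π : IrrClass G) (φ : G → ℂ), 𝔇.IsL2 π → 𝔇.IsPseudoCoeff π φ → ∃ fH : H → ℂ, S_H fH ∧ M fH φ)
    (hMT : ∀ (fH : H → ℂ) (φ : G → ℂ), M fH φ → 𝔇.IsTransfer φ fH)
    (aX : IrrClass G → ℤ) (hall : ∀ π : IrrClass G, aX π ≠ 0 → 𝔇.IsL2 π)
    (hid : ∀ (π₀ : IrrClass G) (fH : H → ℂ) (φ : G → ℂ), 𝔇.IsL2 π₀ → 𝔇.IsPseudoCoeff π₀ φ → S_H fH → M fH φ →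
      Summable (fun π : IrrClass G => (aX π : ℂ) * π.smoothTrace 𝔇.μG φ) ∧
        ∑' π : IrrClass G, (aX π : ℂ) * π.smoothTrace 𝔇.μG φ = R fH)
    (x : G → ℂ) (hx : ∀ T ∈ 𝔇.cartanG, MemLp (fun t : ↥T => (𝔇.DG (t : G) : ℂ) * x (t : G)) 2 (𝔇.μT T))
    (hup : ∀ (π : IrrClass G) (f : G → ℂ) (fH : H → ℂ), 𝔇.IsPseudoCoeff π f → 𝔇.IsTransfer f fH → S_H fH → R fH = 𝔇.innerG x (𝔇.char π)) :
    (Function.support aX).Finite := by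
  have hfin := finite_isL2_innerG_ne_zero_pseudo 𝔇 hTell hEllL2 hpairL2 hL2dom hPCE hPCT h61a h61b h61c S_H M R hTv hMT aX hid x hx hup
  refine hfin.subset fun π hπ => ?_
  rw [Function.mem_support] at hπ
  have hL2 : 𝔇.IsL2 π := hall π hπ
  obtain ⟨f, hf⟩ := hPCE π (hEllL2 π hL2)
  obtain ⟨fH, hfH, hm⟩ := hTv π f hL2 hf
  refine ⟨hL2, ?_⟩
  rw [innerG_eq_coeff_of_members_isL2_pseudo 𝔇 hTell hEllL2 hpairL2 hPCT h61a h61b S_H M R hMT aX hall hid x hup hL2 hf hfH hm]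
  exact_mod_cast hπ

end Summit.HodgeConjecture.HodgeConjecture.Cruxes.H413.F0P3cStCharTSFinOfL2Pseudo

end
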